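import Summits.QuantumAdvantage.QuantumAdvantage.Theorems.CubicForrelationNearExactIsExactTwelveWindowShape29

/-!
# Crux `CubicForrelation.NearExactIsExact` (stmt-QuantumAdvantage-14043) — n = 12, TYPE-O × TYPE-O pairs: the two-sided duality, the MASTER
  IDENTITY, and the theorem that NO TAME (O,O) PAIR EXISTS

Certificate seat `b2b-cforr-cert` (gen 30).  HONEST FRAMING: kernel-checked finite-slice theorems (standard axioms) about cubic Boolean pairs on 12
bits; first bricks for the only pairing left on the open window `(57/64, 29/32)` after `tz30_window_pair_typeO` (both sides type O).  NO new
value of `θ₁₂`; NOT summit progress.  Plan: HOME/b2b-cforr-cert-g30/PLAN-N12-WINDOW-OO.md.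

Setting.  Cubic `F₁, F₂` on 12 bits, BOTH type O: `W_{F₁} = 16u₁`, `W_{F₂} = 16u₂`, all values odd; residuals `τ₁ = u₁ − 4(−1)^{F₂}`,
`τ₂ = u₂ − 4(−1)^{F₁}`.  Digits (`z2_digitOne/Two`): `u ≡ 1 + 2d₁ + 4d₂ (mod 8)`, `d₁` affine — `(−1)^{d₁(x)} = (−1)^b (−1)^{c·x}`
(`stub_affineForm`) —, `d₂` cubic, `E = {d₁ = d₂}` (support of the cubic `κ = [d₁ ↔ d₂]`); base pattern `τ ≡ τ₀ = (−1)^{d₁}(1 − 4·1_E) (mod 8)`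
(`to12_pt_mod8`).  A side is TAME when `τ = τ₀`, i.e. `|τ| ≤ 3` pointwise (no wild point).
* `top_duality`: `Σ_x τ₁(x)(−1)^{x·y} = −64·τ₂(y)` (Walsh inversion; the type-O analogue of `tw_residual_duality`).
* `top_tame_pt`: `|τ| ≤ 3` forces `τ = τ₀` exactly.
* `top_master` (**master identity of a tame pair**): `Σ_{x∈E₁} (−1)^{x·(c₁⊕y)} = 1024·[y = c₁] + 16(−1)^{b₁}(−1)^{b₂}(−1)^{c₂·y}(1 − 4·1_{E₂}(y))`.
* `top_card`: hence `#E₁ = 1024 + 16χ(1 − 4·1_{E₂}(c₁))`, `χ = (−1)^{b₁+b₂+c₁·c₂}`; with Kasami–Tokura (`kt3_weights_twelve`: no cubic weight `976`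
  or `1008`) `1_{E₂}(c₁) = [χ = −1]` and `#E₁ ∈ {1040, 1072}` (`top_card_cases`).
* `top_walsh`: `W_{(−1)^{κ₁}}(z) = 2048·[z = 0] − 32χ(−1)^{c₂·z}(1 − 4·1_{E₂}(c₁ ⊕ z))`; `top_autocorr`: for `t ≠ 0`,
  `Σ_x (−1)^{κ₁(x) ⊕ κ₁(x⊕t)} = 1024 − 128χ(1_{E₁}(c₂ ⊕ t) − 1_{E₂}(c₁))` (Wiener–Khinchin `tb_sum_W_sq_mul_twist` + the master identity twice).
* `top_tame_false` (**NO TAME (O,O) PAIR**): choosing `t = c₂ ⊕ e` with `e ∈ E₁` (`χ = 1`) resp. `e ∉ E₁` (`χ = −1`) gives the value `896`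
  for the Walsh sum at `0` of the QUADRATIC `κ₁ ⊕ κ₁(·⊕t)` (`stub_derivDegree`), contradicting `stub_quadWalshPlateau` (`0` or `±2^s`).
  So every (O,O) pair of cubics on 12 bits — in particular every pair on the open window — has a WILD point (`|τ| ≥ 5`) on some side.

References: T. Kasami, N. Tokura (1970) Thm 1 (in the tree as `kt3_weights_twelve`); C. Carlet (2021) §2.3 (Wiener–Khinchin), §5.1 (Walsh values
of quadratics); R. O'Donnell (2014) §1.4.  Axioms: the standard three.
-/

set_option linter.dupNamespace false -- D-0017: single-problem summit ⇒ `QuantumAdvantage.QuantumAdvantage` by design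

noncomputable section

namespace Summit.QuantumAdvantage.QuantumAdvantage.Theorems.CubicForrelation.NearExactIsExact

open Finset
open Literature.Computability.QuantumComplexity
open Literature.Computability.QuantumComplexity.BuzetChailloux (bxor zeroVec bxor_bxor_cancel_left bxor_zeroVec zeroVec_bxor bxor_comm
  bxor_self twist_bxor_right twist_zeroVec_right sum_twist_left bxor_eq_zeroVec_iff)
open Literature.Computability.QuantumComplexity.DerivativeWalsh (W)

/-! ### Duality and the tame base pattern -/

/-- **Two-sided type-O duality.**  If `W_{F₁} = 16u₁` and `W_{F₂} = 16u₂` (any Boolean `F₁, F₂` on 12 bits) then the Walsh transform of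
`τ₁ = u₁ − 4(−1)^{F₂}` is `−64·τ₂`, `τ₂ = u₂ − 4(−1)^{F₁}`. [folklore] -/
theorem top_duality (F₁ F₂ : (Fin (6 + 6) → Bool) → Bool) (u₁ u₂ : (Fin (6 + 6) → Bool) → ℤ)
    (hu₁ : ∀ x, W (fun y => signOf (F₁ y)) x = (2 : ℝ) ^ 4 * (u₁ x : ℝ))
    (hu₂ : ∀ y, W (fun x => signOf (F₂ x)) y = (2 : ℝ) ^ 4 * (u₂ y : ℝ)) (y : Fin (6 + 6) → Bool) :
    ∑ x, (((u₁ x - 4 * sZ (F₂ x) : ℤ)) : ℝ) * twist x y = -64 * (((u₂ y - 4 * sZ (F₁ y) : ℤ)) : ℝ) := by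
  have hinv := tz_inversion (fun t => signOf (F₁ t)) y
  have h1 : ∑ x, ((u₁ x : ℤ) : ℝ) * twist x y = 256 * signOf (F₁ y) := by
    have h' : ∑ x, ((u₁ x : ℤ) : ℝ) * twist x y = (∑ x, W (fun t => signOf (F₁ t)) x * twist x y) / 2 ^ 4 := by
      rw [eq_div_iff (by norm_num), sum_mul]
      exact sum_congr rfl fun x _ => by rw [hu₁ x]; ring
    rw [h', hinv]; norm_num; ring
  have h2 : ∑ x, ((sZ (F₂ x) : ℤ) : ℝ) * twist x y = (2 : ℝ) ^ 4 * (u₂ y : ℝ) := by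
    rw [← hu₂ y]
    show _ = ∑ x, signOf (F₂ x) * twist x y
    exact sum_congr rfl fun x _ => by rw [tp_sZ_cast]
  have h3 : ∑ x, (((u₁ x - 4 * sZ (F₂ x) : ℤ)) : ℝ) * twist x y =
      ∑ x, ((u₁ x : ℤ) : ℝ) * twist x y - 4 * ∑ x, ((sZ (F₂ x) : ℤ) : ℝ) * twist x y := by
    rw [mul_sum, ← sum_sub_distrib]; exact sum_congr rfl fun x _ => by push_cast; ring
  rw [h3, h1, h2, ← tp_sZ_cast (F₁ y)]
  push_cast
  ring

/-- **Tameness pins the residual to the base pattern.**  For odd `w`, `s = ±1` and `(w − 4s)² ≤ 9`: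
`w − 4s = (−1)^{d₁}(1 − 4·[d₁ ↔ d₂])` exactly (`d₁ = [⌊w/2⌋ odd]`, `d₂ = [⌊w/4⌋ odd]`). [this work] -/
theorem top_tame_pt (w s : ℤ) (hw : Odd w) (hs : s = 1 ∨ s = -1) (ht : (w - 4 * s) ^ 2 ≤ 9) :
    w - 4 * s = sZ (decide (Odd (w / 2))) * (1 - 4 * (if (Odd (w / 2) ↔ Odd (w / 2 / 2)) then 1 else 0)) := by
  obtain ⟨v, hv⟩ := to12_pt_mod8 w s hw hs
  have hb : w - 4 * s ≤ 3 ∧ -3 ≤ w - 4 * s := by constructor <;> nlinarith [ht]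
  rcases tp_sZ_cases (decide (Odd (w / 2))) with h1 | h1 <;> rw [h1] at hv ⊢ <;> split_ifs at hv ⊢ with h2 <;> omega

/-! ### The master identity of a tame pair -/

/-- **Master identity.**  Both sides type O and tame, written with the affine forms `(−1)^{d₁} = (−1)^b(−1)^{c·x}` and the cubic indicators
`κ = [d₁ ↔ d₂]`: `Σ_{x : κ₁ x} (−1)^{x·(c₁⊕y)} = 1024·[y = c₁] + 16(−1)^{b₁}(−1)^{b₂}(−1)^{c₂·y}(1 − 4·[κ₂ y])`. [this work] -/
theorem top_master (F₁ F₂ : (Fin (6 + 6) → Bool) → Bool) (u₁ u₂ : (Fin (6 + 6) → Bool) → ℤ)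
    (hu₁ : ∀ x, W (fun y => signOf (F₁ y)) x = (2 : ℝ) ^ 4 * (u₁ x : ℝ))
    (hu₂ : ∀ y, W (fun x => signOf (F₂ x)) y = (2 : ℝ) ^ 4 * (u₂ y : ℝ))
    (κ₁ κ₂ : (Fin (6 + 6) → Bool) → Bool) (b₁ b₂ : Bool) (c₁ c₂ : Fin (6 + 6) → Bool)
    (h₁ : ∀ x, (((u₁ x - 4 * sZ (F₂ x) : ℤ)) : ℝ) = signOf b₁ * twist c₁ x * (1 - 4 * (if κ₁ x = true then 1 else 0)))
    (h₂ : ∀ y, (((u₂ y - 4 * sZ (F₁ y) : ℤ)) : ℝ) = signOf b₂ * twist c₂ y * (1 - 4 * (if κ₂ y = true then 1 else 0)))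
    (y : Fin (6 + 6) → Bool) :
    ∑ x ∈ univ.filter (fun x => κ₁ x = true), twist x (bxor c₁ y) =
      1024 * (if y = c₁ then 1 else 0) + 16 * (signOf b₁ * signOf b₂) * twist c₂ y * (1 - 4 * (if κ₂ y = true then 1 else 0)) := by
  classical
  have hd := top_duality F₁ F₂ u₁ u₂ hu₁ hu₂ y
  rw [h₂ y, sum_congr rfl fun x _ => by rw [h₁ x]] at hd
  have htw : ∀ x, twist c₁ x * twist x y = twist x (bxor c₁ y) := fun x => by
    rw [Literature.Computability.QuantumComplexity.twist_comm c₁ x, twist_bxor_right]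
  have hsplit : ∑ x, signOf b₁ * twist c₁ x * (1 - 4 * (if κ₁ x = true then (1 : ℝ) else 0)) * twist x y =
      signOf b₁ * (∑ x, twist x (bxor c₁ y) - 4 * ∑ x ∈ univ.filter (fun x => κ₁ x = true), twist x (bxor c₁ y)) := by
    rw [sum_filter, mul_sum, mul_sub, mul_sum, mul_sum, ← sum_sub_distrib]
    refine sum_congr rfl fun x _ => ?_
    rw [← htw x]
    split_ifs <;> ring
  rw [hsplit, sum_twist_left] at hd
  have hδ : (if bxor c₁ y = zeroVec then (2 : ℝ) ^ (6 + 6) else 0) = 4096 * (if y = c₁ then 1 else 0) := by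
    by_cases hy : y = c₁
    · rw [if_pos hy, if_pos ((bxor_eq_zeroVec_iff c₁ y).2 hy.symm)]; norm_num
    · rw [if_neg hy, if_neg (fun h => hy ((bxor_eq_zeroVec_iff c₁ y).1 h).symm)]; norm_num
  rw [hδ] at hd
  have hs1 : signOf b₁ * signOf b₁ = 1 := by cases b₁ <;> simp [signOf]
  linear_combination (-(signOf b₁) / 4) * hd -
    (∑ x ∈ univ.filter (fun x => κ₁ x = true), twist x (bxor c₁ y) - 1024 * (if y = c₁ then (1 : ℝ) else 0)) * hs1

/-! ### The tame pair: setup, cardinalities, Walsh spectrum, autocorrelation -/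

/-- `[p ↔ q] = ¬([p] ⊕ [q])` for decidable propositions. [folklore] -/
theorem top_decide_iff {p q : Prop} [Decidable p] [Decidable q] : decide (p ↔ q) = !(decide p ^^ decide q) := by
  by_cases hp : p <;> by_cases hq : q <;> simp [hp, hq]

/-- `896` is neither `0` nor `±2^s`: `896² ≠ 4^s`. [folklore] -/
theorem top_not_pow (s : ℕ) : (896 : ℝ) ^ 2 ≠ (4 : ℝ) ^ s := by
  intro h
  have h' : (4 : ℕ) ^ s = 802816 := by
    have : ((4 : ℕ) ^ s : ℝ) = 802816 := by push_cast; rw [← h]; norm_num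
    exact_mod_cast this
  rcases le_or_gt s 9 with hs | hs
  · have : (4 : ℕ) ^ s ≤ 4 ^ 9 := Nat.pow_le_pow_right (by norm_num) hs
    omega
  · have : (4 : ℕ) ^ 10 ≤ 4 ^ s := Nat.pow_le_pow_right (by norm_num) hs
    omega

/-- **NO TAME (O,O) PAIR.**  Cubic `F₁, F₂` on 12 bits, both type O (`W_{F₁} = 16u₁`, `W_{F₂} = 16u₂`, all values odd), both residuals
bounded: `(u₁ − 4(−1)^{F₂})² ≤ 9` and `(u₂ − 4(−1)^{F₁})² ≤ 9` pointwise ⇒ `False`.  Hence every (O,O) pair of cubics on 12 bits has a wild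
point (`|τ| ≥ 5`) on at least one side.  Finite-slice statement, NOT summit progress. [this work] -/
theorem top_tame_false (F₁ F₂ : (Fin (6 + 6) → Bool) → Bool) (hF₁ : IsDegLeFun 3 F₁) (hF₂ : IsDegLeFun 3 F₂)
    (u₁ u₂ : (Fin (6 + 6) → Bool) → ℤ)
    (hu₁ : ∀ x, W (fun y => signOf (F₁ y)) x = (2 : ℝ) ^ 4 * (u₁ x : ℝ))
    (hu₂ : ∀ y, W (fun x => signOf (F₂ x)) y = (2 : ℝ) ^ 4 * (u₂ y : ℝ))
    (ho₁ : ∀ x, Odd (u₁ x)) (ho₂ : ∀ y, Odd (u₂ y))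
    (ht₁ : ∀ x, (u₁ x - 4 * sZ (F₂ x)) ^ 2 ≤ 9) (ht₂ : ∀ y, (u₂ y - 4 * sZ (F₁ y)) ^ 2 ≤ 9) : False := by
  classical
  -- digits and the cubic indicators `κ = [d₁ ↔ d₂]`
  set κ₁ : (Fin (6 + 6) → Bool) → Bool := fun x => decide (Odd (u₁ x / 2) ↔ Odd (u₁ x / 2 / 2)) with hκ₁def
  set κ₂ : (Fin (6 + 6) → Bool) → Bool := fun y => decide (Odd (u₂ y / 2) ↔ Odd (u₂ y / 2 / 2)) with hκ₂def
  have hu₁' : ∀ x, W (fun y => signOf (F₁ y)) x = (2 : ℝ) ^ (2 * 2) * (u₁ x : ℝ) := fun x => (hu₁ x).trans (by norm_num)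
  have hu₂' : ∀ y, W (fun x => signOf (F₂ x)) y = (2 : ℝ) ^ (2 * 2) * (u₂ y : ℝ) := fun y => (hu₂ y).trans (by norm_num)
  have hd1₁ : IsDegLeFun 1 (fun x => decide (Odd (u₁ x / 2))) := z2_digitOne 2 F₁ u₁ hF₁ hu₁' ho₁
  have hd2₁ : IsDegLeFun 3 (fun x => decide (Odd (u₁ x / 2 / 2))) := z2_digitTwo 2 F₁ u₁ hF₁ hu₁' ho₁
  have hd1₂ : IsDegLeFun 1 (fun y => decide (Odd (u₂ y / 2))) := z2_digitOne 2 F₂ u₂ hF₂ hu₂' ho₂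
  have hd2₂ : IsDegLeFun 3 (fun y => decide (Odd (u₂ y / 2 / 2))) := z2_digitTwo 2 F₂ u₂ hF₂ hu₂' ho₂
  have hκ₁ : IsDegLeFun 3 κ₁ := by
    have h := (bb_isDegLeFun_bxor (hd1₁.mono (by norm_num)) hd2₁).not
    have e : κ₁ = fun x => !(decide (Odd (u₁ x / 2)) ^^ decide (Odd (u₁ x / 2 / 2))) := by
      funext x; exact top_decide_iff
    rw [e]; exact h
  have hκ₂ : IsDegLeFun 3 κ₂ := by
    have h := (bb_isDegLeFun_bxor (hd1₂.mono (by norm_num)) hd2₂).not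
    have e : κ₂ = fun y => !(decide (Odd (u₂ y / 2)) ^^ decide (Odd (u₂ y / 2 / 2))) := by
      funext y; exact top_decide_iff
    rw [e]; exact h
  -- affine forms of the first digits
  obtain ⟨c₁, b₁, hc₁⟩ := stub_affineForm (6 + 6) (fun x => decide (Odd (u₁ x / 2))) hd1₁
  obtain ⟨c₂, b₂, hc₂⟩ := stub_affineForm (6 + 6) (fun y => decide (Odd (u₂ y / 2))) hd1₂
  -- tameness: `τ = τ₀` exactly, in real form
  have h₁ : ∀ x, (((u₁ x - 4 * sZ (F₂ x) : ℤ)) : ℝ) = signOf b₁ * twist c₁ x * (1 - 4 * (if κ₁ x = true then 1 else 0)) := by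
    intro x
    rw [top_tame_pt (u₁ x) (sZ (F₂ x)) (ho₁ x) (tp_sZ_cases _) (ht₁ x)]
    push_cast
    rw [tp_sZ_cast, hc₁ x]
    simp only [κ₁, decide_eq_true_eq]
  have h₂ : ∀ y, (((u₂ y - 4 * sZ (F₁ y) : ℤ)) : ℝ) = signOf b₂ * twist c₂ y * (1 - 4 * (if κ₂ y = true then 1 else 0)) := by
    intro y
    rw [top_tame_pt (u₂ y) (sZ (F₁ y)) (ho₂ y) (tp_sZ_cases _) (ht₂ y)]
    push_cast
    rw [tp_sZ_cast, hc₂ y]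
    simp only [κ₂, decide_eq_true_eq]
  -- the master identity for both sides
  have hM₁ := top_master F₁ F₂ u₁ u₂ hu₁ hu₂ κ₁ κ₂ b₁ b₂ c₁ c₂ h₁ h₂
  have hM₂ := top_master F₂ F₁ u₂ u₁ hu₂ hu₁ κ₂ κ₁ b₂ b₁ c₂ c₁ h₂ h₁
  set E₁ := univ.filter (fun x => κ₁ x = true) with hE₁def
  set χ : ℝ := signOf b₁ * signOf b₂ * twist c₂ c₁ with hχdef
  have hsb : ∀ b : Bool, signOf b = 1 ∨ signOf b = -1 := fun b => by cases b <;> simp [signOf]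
  have hχ : χ = 1 ∨ χ = -1 := by
    rcases hsb b₁ with h1 | h1 <;> rcases hsb b₂ with h2 | h2 <;>
      rcases Literature.Computability.QuantumComplexity.Simon.twist_eq_one_or c₂ c₁ with h3 | h3 <;>
        · rw [hχdef, h1, h2, h3]; norm_num
  have hχsq : χ * χ = 1 := by rcases hχ with h | h <;> rw [h] <;> norm_num
  -- `#E₁ = 1024 + 16χ(1 − 4·[κ₂ c₁])`
  have hcard : (#E₁ : ℝ) = 1024 + 16 * χ * (1 - 4 * (if κ₂ c₁ = true then 1 else 0)) := by
    have h := hM₁ c₁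
    rw [bxor_self, if_pos rfl] at h
    have e : ∑ x ∈ E₁, twist x (zeroVec : Fin (6 + 6) → Bool) = #E₁ := by
      rw [sum_congr rfl fun x _ => twist_zeroVec_right x, sum_const, nsmul_eq_mul, mul_one]
    rw [e] at h
    rw [h, hχdef]
    ring
  -- Kasami–Tokura: `976`, `1008` are not cubic weights ⇒ `[κ₂ c₁] = [χ = −1]`
  have hKT : (χ = 1 ∧ κ₂ c₁ = false ∧ #E₁ = 1040) ∨ (χ = -1 ∧ κ₂ c₁ = true ∧ #E₁ = 1072) := by
    have hkt := kt3_weights_twelve κ₁ hκ₁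
    rcases hχ with h | h <;> cases hk : κ₂ c₁
    · left
      rw [h, hk] at hcard; norm_num at hcard
      exact ⟨h, rfl, by exact_mod_cast hcard⟩
    · exfalso
      rw [h, hk] at hcard; norm_num at hcard
      have hc : #E₁ = 976 := by exact_mod_cast hcard
      have h6 := hkt (by rw [hc]; norm_num)
      rw [hc] at h6; norm_num at h6
    · exfalso
      rw [h, hk] at hcard; norm_num at hcard
      have hc : #E₁ = 1008 := by exact_mod_cast hcard
      have h6 := hkt (by rw [hc]; norm_num)
      rw [hc] at h6; norm_num at h6
    · right
      rw [h, hk] at hcard; norm_num at hcard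
      exact ⟨h, rfl, by exact_mod_cast hcard⟩
  -- the Walsh spectrum of `(−1)^{κ₁}`
  set G₁ : (Fin (6 + 6) → Bool) → ℝ := fun x => signOf (κ₁ x) with hG₁def
  have hsignOf_ind : ∀ b : Bool, signOf b = 1 - 2 * (if b = true then (1 : ℝ) else 0) := fun b => by
    cases b <;> norm_num [signOf]
  have hW : ∀ z, W G₁ z = 2048 * (if z = zeroVec then 1 else 0) -
      32 * χ * twist c₂ z * (1 - 4 * (if κ₂ (bxor c₁ z) = true then 1 else 0)) := by
    intro z
    have hm := hM₁ (bxor c₁ z)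
    rw [bxor_bxor_cancel_left] at hm
    have e1 : W G₁ z = ∑ x, twist x z - 2 * ∑ x ∈ E₁, twist x z := by
      show ∑ x, signOf (κ₁ x) * twist x z = _
      rw [hE₁def, sum_filter, mul_sum, ← sum_sub_distrib]
      refine sum_congr rfl fun x _ => ?_
      rw [hsignOf_ind]; split_ifs <;> ring
    have e2 : (if bxor c₁ z = c₁ then (1 : ℝ) else 0) = if z = zeroVec then 1 else 0 := by
      by_cases hz : z = zeroVec
      · rw [if_pos hz, if_pos (by rw [hz, bxor_zeroVec])]
      · rw [if_neg hz, if_neg (fun h => hz ?_)]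
        have := congrArg (bxor c₁) h
        rwa [bxor_bxor_cancel_left, bxor_self] at this
    rw [e1, sum_twist_left, hm, e2, twist_bxor_right, hχdef]
    by_cases hz : z = zeroVec
    · rw [if_pos hz, if_pos hz]; norm_num; ring
    · rw [if_neg hz, if_neg hz]; ring
  -- autocorrelation at `t ≠ 0`
  have hauto : ∀ t, t ≠ zeroVec → ∑ x, G₁ x * G₁ (bxor x t) =
      1024 - 128 * χ * ((if κ₁ (bxor c₂ t) = true then 1 else 0) - (if κ₂ c₁ = true then 1 else 0)) := by
    intro t ht
    have hWK := tb_sum_W_sq_mul_twist G₁ t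
    -- `W(z)² = 1024(1 + 8[κ₂(c₁⊕z)]) + [z=0](2048² − 131072χ(1 − 4[κ₂ c₁]))`
    have hsq : ∀ z, W G₁ z ^ 2 * twist z t = 1024 * twist z t + 8192 * ((if κ₂ (bxor c₁ z) = true then 1 else 0) * twist z t) +
        (if z = zeroVec then (1 : ℝ) else 0) * (4194304 - 131072 * χ * (1 - 4 * (if κ₂ c₁ = true then 1 else 0))) := by
      intro z
      have htz : twist c₂ z ^ 2 = 1 := by
        rw [sq]; exact Literature.Computability.QuantumComplexity.Simon.twist_mul_self c₂ z
      have hχ2 : χ ^ 2 = 1 := by rw [sq]; exact hχsq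
      have hk2 : ∀ b : Bool, (if b = true then (1 : ℝ) else 0) ^ 2 = (if b = true then (1 : ℝ) else 0) := fun b => by
        cases b <;> norm_num
      by_cases hz : z = zeroVec
      · have hW0 : W G₁ z = 2048 - 32 * χ * (1 - 4 * (if κ₂ c₁ = true then 1 else 0)) := by
          rw [hW z, if_pos hz, hz, bxor_zeroVec, twist_zeroVec_right]; ring
        have ht0 : twist z t = 1 := by
          rw [hz, Literature.Computability.QuantumComplexity.twist_comm, twist_zeroVec_right]
        rw [hW0, ht0, if_pos hz, hz, bxor_zeroVec]
        linear_combination (1024 * (1 - 4 * (if κ₂ c₁ = true then (1 : ℝ) else 0)) ^ 2) * hχ2 +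
          16384 * hk2 (κ₂ c₁)
      · have hW1 : W G₁ z = -(32 * (1 - 4 * (if κ₂ (bxor c₁ z) = true then 1 else 0))) * (χ * twist c₂ z) := by
          rw [hW z, if_neg hz]; ring
        rw [hW1, if_neg hz]
        linear_combination (1024 * (1 - 4 * (if κ₂ (bxor c₁ z) = true then (1 : ℝ) else 0)) ^ 2 * twist z t * twist c₂ z ^ 2) * hχ2 +
          (1024 * (1 - 4 * (if κ₂ (bxor c₁ z) = true then (1 : ℝ) else 0)) ^ 2 * twist z t) * htz +
          (16384 * twist z t) * hk2 (κ₂ (bxor c₁ z))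
    rw [sum_congr rfl fun z _ => hsq z, sum_add_distrib, sum_add_distrib, ← mul_sum, ← mul_sum, ← sum_mul, sum_twist_left,
      if_neg ht] at hWK
    -- `Σ_z [z = 0] = 1` and the reindexed sum `Σ_z [κ₂(c₁⊕z)] twist z t = twist c₁ t · Σ_{E₂} twist w t`
    have hδ : ∑ z : Fin (6 + 6) → Bool, (if z = zeroVec then (1 : ℝ) else 0) = 1 := by
      rw [sum_ite_eq']; simp
    have hre : ∑ z, (if κ₂ (bxor c₁ z) = true then (1 : ℝ) else 0) * twist z t =
        twist c₁ t * ∑ w ∈ univ.filter (fun w => κ₂ w = true), twist w t := by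
      rw [sum_filter, mul_sum]
      refine Fintype.sum_equiv (Literature.Computability.QuantumComplexity.BuzetChailloux.bxorPerm c₁) _ _ fun z => ?_
      simp only [Literature.Computability.QuantumComplexity.BuzetChailloux.bxorPerm_apply]
      split_ifs with h
      · rw [Literature.Computability.QuantumComplexity.DerivativeWalsh.twist_bxor_left, one_mul, ← mul_assoc,
          Literature.Computability.QuantumComplexity.Simon.twist_mul_self, one_mul]
      · ring
    have hm2 := hM₂ (bxor c₂ t)
    rw [bxor_bxor_cancel_left, twist_bxor_right] at hm2
    have e3 : (if bxor c₂ t = c₂ then (1 : ℝ) else 0) = 0 := by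
      rw [if_neg]; intro h; apply ht
      have := congrArg (bxor c₂) h
      rwa [bxor_bxor_cancel_left, bxor_self] at this
    rw [e3] at hm2
    rw [hδ, hre, hm2] at hWK
    have htt : twist c₁ t * twist c₁ t = 1 := Literature.Computability.QuantumComplexity.Simon.twist_mul_self c₁ t
    have hcc : twist c₁ c₂ = twist c₂ c₁ := Literature.Computability.QuantumComplexity.twist_comm c₁ c₂
    have h4096 : (2 : ℝ) ^ (6 + 6) = 4096 := by norm_num
    rw [h4096, hcc] at hWK
    have hχ' : signOf b₂ * signOf b₁ * twist c₂ c₁ = χ := by rw [hχdef]; ring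
    -- solve for the autocorrelation
    have htt2 : twist c₁ t ^ 2 = 1 := by rw [sq]; exact htt
    have key : 4096 * ∑ x, G₁ x * G₁ (bxor x t) =
        4194304 - 524288 * χ * ((if κ₁ (bxor c₂ t) = true then 1 else 0) - (if κ₂ c₁ = true then 1 else 0)) := by
      linear_combination (-1 : ℝ) * hWK +
        (131072 * (1 - 4 * (if κ₁ (bxor c₂ t) = true then (1 : ℝ) else 0)) * twist c₁ t ^ 2) * hχ' +
        (131072 * (1 - 4 * (if κ₁ (bxor c₂ t) = true then (1 : ℝ) else 0)) * χ) * htt2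
    linarith
  -- the autocorrelation is the Walsh value at `0` of the quadratic `κ₁ ⊕ κ₁(·⊕t)`
  have hquad : ∀ t, ∃ s : ℕ, ∑ x, G₁ x * G₁ (bxor x t) = 0 ∨ (∑ x, G₁ x * G₁ (bxor x t)) ^ 2 = (4 : ℝ) ^ s := by
    intro t
    have hdeg : IsDegLeFun 2 (fun x => κ₁ x ^^ κ₁ (bxor x t)) := stub_derivDegree (6 + 6) 2 κ₁ t hκ₁
    obtain ⟨s, hs⟩ := stub_quadWalshPlateau (6 + 6) _ hdeg
    refine ⟨s, ?_⟩
    have e : W (fun x => signOf (κ₁ x ^^ κ₁ (bxor x t))) zeroVec = ∑ x, G₁ x * G₁ (bxor x t) := by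
      show ∑ x, signOf (κ₁ x ^^ κ₁ (bxor x t)) * twist x zeroVec = _
      exact sum_congr rfl fun x _ => by
        rw [Literature.Computability.QuantumComplexity.signOf_xor, twist_zeroVec_right, mul_one]
    rw [← e]
    exact hs zeroVec
  -- a witness `t` with autocorrelation `896`
  have hex : ∃ t, t ≠ zeroVec ∧ ∑ x, G₁ x * G₁ (bxor x t) = 896 := by
    rcases hKT with ⟨hχ1, hk, hc⟩ | ⟨hχ1, hk, hc⟩
    · -- `χ = 1`: take `e ∈ E₁`, `e ≠ c₂`
      obtain ⟨e, he, hne⟩ : ∃ e, e ∈ E₁ ∧ e ∉ ({c₂} : Finset (Fin (6 + 6) → Bool)) :=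
        exists_mem_notMem_of_card_lt_card (by rw [card_singleton, hc]; norm_num)
      refine ⟨bxor c₂ e, fun h => ?_, ?_⟩
      · exact (notMem_singleton.1 hne) ((bxor_eq_zeroVec_iff c₂ e).1 h).symm
      · rw [hauto _ (fun h => (notMem_singleton.1 hne) ((bxor_eq_zeroVec_iff c₂ e).1 h).symm), bxor_bxor_cancel_left,
          hχ1, hk, if_pos (mem_filter.1 he).2]
        norm_num
    · -- `χ = −1`: take `e ∉ E₁`, `e ≠ c₂`
      obtain ⟨e, he, hne⟩ : ∃ e, e ∈ (univ \ E₁) ∧ e ∉ ({c₂} : Finset (Fin (6 + 6) → Bool)) :=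
        exists_mem_notMem_of_card_lt_card (by
          rw [card_singleton, card_univ_sdiff, Fintype.card_fun, Fintype.card_bool, Fintype.card_fin, hc]
          norm_num)
      have he' : κ₁ e = false := by
        have := (mem_sdiff.1 he).2
        rw [hE₁def, mem_filter] at this
        cases h : κ₁ e
        · rfl
        · exact (this ⟨mem_univ _, h⟩).elim
      refine ⟨bxor c₂ e, fun h => ?_, ?_⟩
      · exact (notMem_singleton.1 hne) ((bxor_eq_zeroVec_iff c₂ e).1 h).symm
      · rw [hauto _ (fun h => (notMem_singleton.1 hne) ((bxor_eq_zeroVec_iff c₂ e).1 h).symm), bxor_bxor_cancel_left,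
          hχ1, hk, he']
        norm_num
  obtain ⟨t, -, h896⟩ := hex
  obtain ⟨s, hs⟩ := hquad t
  rw [h896] at hs
  rcases hs with h | h
  · norm_num at h
  · exact top_not_pow s h

end Summit.QuantumAdvantage.QuantumAdvantage.Theorems.CubicForrelation.NearExactIsExact

end
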